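import Literature.Computability.QuantumComplexity.OraclePreprocessWrap
import Literature.Computability.Complexity.FPRASAmplification
import Literature.Computability.Complexity.PlumbingBricks
import Literature.Computability.Complexity.FPStringBricks
import HarnessLib

/-!
# Numeric advice from a quantum subroutine, amplified by the median, I: the stage family

Topic `Literature/Computability/QuantumComplexity`; the oracle-free sibling of
`OraclePreprocessWrap.lean`, consumed by `AdviceChain.lean`
(`AdviceChain.isQSolvable_of_numericAdvice`: a bounded-error quantum solver for a NUMERIC ADVICE
relation — on query `q` output `⟨bin r, ·⟩` with `good q r`, the good values forming an interval —
and a main quantum stage succeeding with probability `≥ 11/12` on good advice compose into a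
bounded-error solver for the goal). The
composition is the textbook one: run the advice solver several times, take the MEDIAN of the
answers (Jerrum–Valiant–Vazirani 1986, Lemma 6.1: the median of a list more than half of whose
entries lie in an interval lies in the interval; Bennett–Bernstein–Brassard–Vazirani 1997,
Thm. 4.13: independent repetitions of a bounded-error machine), then call the main stage on the
amplified advice (BBBV 1997, Thm. 4.14: subroutine calls on computed inputs; Bernstein–Vazirani
1997, §8: classical computation is free inside quantum machines). In the tree's circuit model the
runs are the stages of a sequential chain (`SeqChain.family`, `StageChains.chainLaw`: stage `k`
receives `⟨w, ⟨1ᵏ, y_k⟩⟩`, `y_k` the window of the previous stage's measured register,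
Nielsen–Chuang 2010, §4.4). This file provides

* `AdviceChain.exists_classicalWrap_oracleFree` — the classical wrap `CWrap.family` in kernel
  form for ORACLE-FREE families (oracle-freeness is kept, `CWrap.family_isOracleFree`);
* **`AdviceChain.exists_stageFamily`** — ONE oracle-free uniform Clifford+`T` family `S` serving
  both jobs, dispatching on the stage counter: on `⟨w, ⟨1ᵏ, y⟩⟩` with `k < M` it runs the advice
  family `FA` on `qry w` and writes the self-delimited list `⟨fstF y ++ ⟨canonF (fstF y'), []⟩, []⟩`
  (the coded list `fstF y` of the window extended by the canonical numeral of the answer `y'`);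
  on `⟨w, ⟨1ᴹ, y⟩⟩` it runs the main family `F` on `pre ⟨w, med y⟩` and writes
  `⟨post ⟨⟨w, med y⟩, y''⟩, []⟩`. Construction: the parity sum (`QCircuitFamily.paritySum`) of the
  two classical wraps, inside a dispatcher wrap padding the input with `1^{k - (M-1)}`;
* the bookkeeping of `AdviceChain.lean`: the two-level Markov bound `le_toOuterMeasure_bind_two`
  for one step of an iterated `PMF.bind` (behind the domination of the number of good answers by a
  binomial law), the median of a sorted list with a good majority under an interval condition
  (`good_getD_of_majority`), and small facts on coded lists (`encList`) and output kernels.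

Everything here is proved; no definition and no named fact is introduced.

## References

* C. H. Bennett, E. Bernstein, G. Brassard, U. Vazirani, *Strengths and weaknesses of quantum
  computing*, SIAM J. Comput. 26 (1997) 1510–1523, Thm. 4.13, Thm. 4.14
  [BennettBernsteinBrassardVazirani1997].
* E. Bernstein, U. Vazirani, *Quantum complexity theory*, SIAM J. Comput. 26 (1997), §8
  [BernsteinVazirani1997].
* M. R. Jerrum, L. G. Valiant, V. V. Vazirani, *Random generation of combinatorial structures from
  a uniform distribution*, Theoret. Comput. Sci. 43 (1986) 169–188, Lemma 6.1
  [JerrumValiantVazirani1986].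
* M. A. Nielsen, I. L. Chuang, *Quantum Computation and Quantum Information*, CUP 2010, §4.4
  [NielsenChuang2010].
-/

noncomputable section

namespace Literature.Computability.QuantumComplexity

namespace AdviceChain

open _root_.Computability Complexity Complexity.Brick Cryptography Polynomial

/-! ### The stage family -/

/-- **The classical wrap of an oracle-free family, in kernel form.** For `h, g ∈ FP` and an
oracle-free uniform family `F` there is an oracle-free uniform family `F'` which on input `x`
outputs a string with a prefix `g ⟨x, y⟩`, `y ∈ R`, with probability at least
`Pr[F on h x outputs a string of R]`, for every event `R` (`CWrap.family`, files
`CWrapLayout.lean` … `CWrapAssembly.lean`).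
[cite: BernsteinVazirani1997, §8 (classical computation inside quantum machines)] -/
theorem exists_classicalWrap_oracleFree {h g : List Bool → List Bool} (hh : h ∈ FP) (hg : g ∈ FP)
    {F : QCircuitFamily cliffordT} (hfree : F.IsOracleFree) (hU : F.IsUniform) :
    ∃ F' : QCircuitFamily cliffordT, F'.IsOracleFree ∧ F'.IsUniform ∧
      ∀ (x : List Bool) (R : Set (List Bool)),
        F.kernelProb 0 (h x) R ≤ F'.kernelProb 0 x {z | ∃ y ∈ R, g (boolPair x y) <+: z} := by
  obtain ⟨P, rfl, rfl, rfl⟩ := CWrap.exists_params hh hg hU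
  exact ⟨CWrap.family P, CWrap.family_isOracleFree P hfree, CWrap.family_isUniform P hU,
    fun x R => CWrap.kernelProb_family_ge P x (fun _ => R)⟩

/-- **The stage family of the advice chain.** For `qry, pre, post, med ∈ FP`, oracle-free uniform
families `FA` (the advice solver) and `F` (the main stage) and `M ≥ 1` there is ONE oracle-free
uniform Clifford+`T` family `S` such that, for every event `Ev`,

* on a stage input `⟨w, ⟨1ᵏ, y⟩⟩` with `k < M` the measured register has a prefix
  `⟨fstF y ++ ⟨canonF (fstF y'), []⟩, []⟩` with `y' ∈ Ev` with probability at least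
  `Pr[FA on qry w outputs a string of Ev]` (the coded list in the window grows by the canonical
  numeral `canonF (fstF y') = bin (decodeNat (fstF y'))` of the answer);
* on `⟨w, ⟨1ᴹ, y⟩⟩` the measured register has a prefix `⟨post ⟨⟨w, med y⟩, y''⟩, []⟩` with
  `y'' ∈ Ev` with probability at least `Pr[F on pre ⟨w, med y⟩ outputs a string of Ev]`.

Construction: the dispatcher wrap sends `u = ⟨w, ⟨1ᵏ, y⟩⟩` to `⟨u, 1^{k-(M-1)}⟩` — even length
iff `k < M` — into the parity sum (`QCircuitFamily.paritySum`) of the wrap of `FA` (reading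
`qry (fstF (fstF ·))`, appending the canonical answer to the list read off the window) and of the
wrap of `F` (reading `pre ⟨w, med y⟩`, writing `⟨post _, []⟩`), and copies the answer.
[cite: BernsteinVazirani1997, §8 (classical computation and subroutines inside quantum machines)] -/
theorem exists_stageFamily (M : ℕ) (hM : 0 < M) {qry pre post med : List Bool → List Bool}
    (hqry : qry ∈ FP) (hpre : pre ∈ FP) (hpost : post ∈ FP) (hmed : med ∈ FP)
    {FA F : QCircuitFamily cliffordT} (hAfree : FA.IsOracleFree) (hAU : FA.IsUniform)
    (hFfree : F.IsOracleFree) (hFU : F.IsUniform) :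
    ∃ S : QCircuitFamily cliffordT, S.IsOracleFree ∧ S.IsUniform ∧
      (∀ (w : List Bool) (k : ℕ) (y : List Bool), k < M → ∀ Ev : Set (List Bool),
        FA.kernelProb 0 (qry w) Ev ≤ S.kernelProb 0 (stageInput w k y)
          {z | ∃ y' ∈ Ev, boolPair (fstF y ++ boolPair (canonF (fstF y')) []) [] <+: z}) ∧
      (∀ (w y : List Bool) (Ev : Set (List Bool)),
        F.kernelProb 0 (pre (boolPair w (med y))) Ev ≤ S.kernelProb 0 (stageInput w M y)
          {z | ∃ y' ∈ Ev, boolPair (post (boolPair (boolPair w (med y)) y')) [] <+: z}) := by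
  -- the advice job: query `qry w`, append the canonical numeral of the answer to the window's list
  have hh₀ : (qry ∘ fstF ∘ fstF) ∈ FP := comp_mem_FP hqry (comp_mem_FP fstF_mem_FP fstF_mem_FP)
  have hL : (fstF ∘ sndF ∘ sndF ∘ fstF ∘ fstF : List Bool → List Bool) ∈ FP :=
    comp_mem_FP fstF_mem_FP (comp_mem_FP sndF_mem_FP (comp_mem_FP sndF_mem_FP
      (comp_mem_FP fstF_mem_FP fstF_mem_FP)))
  have hitem : (fanoutFn (canonF ∘ fstF ∘ sndF) (fun _ => ([] : List Bool))) ∈ FP :=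
    fanoutFn_mem_FP (comp_mem_FP canonF_mem_FP (comp_mem_FP fstF_mem_FP sndF_mem_FP))
      (const_mem_FP _)
  set g₀ : List Bool → List Bool := fanoutFn (fun z => (fstF ∘ sndF ∘ sndF ∘ fstF ∘ fstF) z ++
      (fanoutFn (canonF ∘ fstF ∘ sndF) (fun _ => ([] : List Bool))) z) (fun _ => ([] : List Bool))
    with hg₀
  have hg₀mem : g₀ ∈ FP := fanoutFn_mem_FP (append_mem_FP hL hitem) (const_mem_FP _)
  obtain ⟨F₀, hF₀free, hF₀U, hF₀⟩ := exists_classicalWrap_oracleFree hh₀ hg₀mem hAfree hAU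
  -- the main job: read the advice off the window, run `F` on `pre ⟨w, advice⟩`, write `post`
  set advF : List Bool → List Bool := fanoutFn (fstF ∘ fstF) (med ∘ sndF ∘ sndF ∘ fstF) with hadvF
  have hadv : advF ∈ FP := fanoutFn_mem_FP (comp_mem_FP fstF_mem_FP fstF_mem_FP)
    (comp_mem_FP hmed (comp_mem_FP sndF_mem_FP (comp_mem_FP sndF_mem_FP fstF_mem_FP)))
  have hh₁ : (pre ∘ advF) ∈ FP := comp_mem_FP hpre hadv
  set g₁ : List Bool → List Bool :=
    fanoutFn (post ∘ fanoutFn (advF ∘ fstF) sndF) (fun _ => ([] : List Bool)) with hg₁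
  have hg₁mem : g₁ ∈ FP := fanoutFn_mem_FP (comp_mem_FP hpost
    (fanoutFn_mem_FP (comp_mem_FP hadv fstF_mem_FP) sndF_mem_FP)) (const_mem_FP _)
  obtain ⟨F₁, hF₁free, hF₁U, hF₁⟩ := exists_classicalWrap_oracleFree hh₁ hg₁mem hFfree hFU
  -- the dispatcher: pad with the stage counter beyond `M - 1` (even length iff `k < M`)
  set disp : List Bool → List Bool :=
    fanoutFn (fun z => z) (Plumb.dropFn ∘ fanoutFn (fun _ => ones (M - 1)) (fstF ∘ sndF)) with hdisp
  have hdispmem : disp ∈ FP := fanoutFn_mem_FP (PolyTimeComputable.id _)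
    (comp_mem_FP Plumb.dropFn_mem_FP
      (fanoutFn_mem_FP (const_mem_FP _) (comp_mem_FP fstF_mem_FP sndF_mem_FP)))
  obtain ⟨S, hSfree, hSU, hS⟩ := exists_classicalWrap_oracleFree hdispmem sndF_mem_FP
    (QCircuitFamily.paritySum_isOracleFree hF₀free hF₁free)
    (QCircuitFamily.paritySum_isUniform hF₀U hF₁U)
  have hdisp_apply : ∀ (w y : List Bool) (k : ℕ),
      disp (stageInput w k y) =
        boolPair (stageInput w k y) (List.replicate (k - (M - 1)) true) := by
    intro w y k
    simp only [hdisp, stageInput, fanoutFn_apply, Function.comp_apply, fstF_boolPair, sndF_boolPair,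
      Plumb.dropFn_boolPair, List.length_replicate, List.drop_replicate]
  refine ⟨S, hSfree, hSU, fun w k y hk Ev => ?_, fun w y Ev => ?_⟩
  · -- advice stages
    have heven : Even (disp (stageInput w k y)).length := by
      rw [hdisp_apply, length_boolPair, List.length_replicate, Nat.sub_eq_zero_of_le (by omega),
        Nat.add_zero]
      exact ⟨(stageInput w k y).length + 1, by ring⟩
    have h0 := hS (stageInput w k y)
      {t | ∃ y' ∈ Ev, g₀ (boolPair (disp (stageInput w k y)) y') <+: t}
    rw [QCircuitFamily.kernelProb_paritySum_of_even 0 heven] at h0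
    have h1 := hF₀ (disp (stageInput w k y)) Ev
    have hq : (qry ∘ fstF ∘ fstF) (disp (stageInput w k y)) = qry w := by
      rw [hdisp_apply]; simp only [Function.comp_apply, fstF_boolPair, stageInput]
    rw [hq] at h1
    refine h1.trans (h0.trans (kernelProb_mono _ _ _ ?_))
    rintro z ⟨t, ⟨y', hy', hy't⟩, htz⟩
    refine ⟨y', hy', ?_⟩
    have e : g₀ (boolPair (disp (stageInput w k y)) y') =
        boolPair (fstF y ++ boolPair (canonF (fstF y')) []) [] := by
      rw [hdisp_apply]
      simp only [hg₀, fanoutFn_apply, Function.comp_apply, fstF_boolPair, sndF_boolPair, stageInput]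
    rw [sndF_boolPair] at htz
    rw [e] at hy't
    exact hy't.trans htz
  · -- the main stage
    have hodd : ¬ Even (disp (stageInput w M y)).length := by
      rw [hdisp_apply, length_boolPair, List.length_replicate, Nat.not_even_iff_odd,
        show M - (M - 1) = 1 by omega]
      exact ⟨(stageInput w M y).length + 1, by ring⟩
    have h0 := hS (stageInput w M y)
      {t | ∃ y' ∈ Ev, g₁ (boolPair (disp (stageInput w M y)) y') <+: t}
    rw [QCircuitFamily.kernelProb_paritySum_of_not_even 0 hodd] at h0
    have h1 := hF₁ (disp (stageInput w M y)) Ev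
    have hadv_apply : advF (disp (stageInput w M y)) = boolPair w (med y) := by
      rw [hdisp_apply]
      simp only [hadvF, fanoutFn_apply, Function.comp_apply, fstF_boolPair, sndF_boolPair,
        stageInput]
    have hq : (pre ∘ advF) (disp (stageInput w M y)) = pre (boolPair w (med y)) := by
      rw [Function.comp_apply, hadv_apply]
    rw [hq] at h1
    refine h1.trans (h0.trans (kernelProb_mono _ _ _ ?_))
    rintro z ⟨t, ⟨y', hy', hy't⟩, htz⟩
    refine ⟨y', hy', ?_⟩
    have e : g₁ (boolPair (disp (stageInput w M y)) y') =
        boolPair (post (boolPair (boolPair w (med y)) y')) [] := by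
      simp only [hg₁, fanoutFn_apply, Function.comp_apply, fstF_boolPair, sndF_boolPair, hadv_apply]
    rw [sndF_boolPair] at htz
    rw [e] at hy't
    exact hy't.trans htz

/-! ### Bookkeeping: one step of a chain, the median, coded lists, output kernels -/

/-- **A two-level Markov bound for one step of a chain.** If from every point of `A` the next
stage hits `E` with probability `≥ c + d`, and from every point of `B ⊇ A` with probability
`≥ d`, then the composite hits `E` with probability `≥ c·Pr[A] + d·Pr[B]`. [folklore] -/
theorem le_toOuterMeasure_bind_two {α β : Type*} {p : PMF α} {q : α → PMF β} {A B : Set α}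
    {E : Set β} {c d : ENNReal} (hAB : A ⊆ B) (hA : ∀ y ∈ A, c + d ≤ (q y).toOuterMeasure E)
    (hB : ∀ y ∈ B, d ≤ (q y).toOuterMeasure E) :
    c * p.toOuterMeasure A + d * p.toOuterMeasure B ≤ (p.bind q).toOuterMeasure E := by
  classical
  rw [PMF.toOuterMeasure_bind_apply, PMF.toOuterMeasure_apply, PMF.toOuterMeasure_apply,
    ← ENNReal.tsum_mul_left, ← ENNReal.tsum_mul_left, ← ENNReal.tsum_add]
  refine ENNReal.tsum_le_tsum fun y => ?_
  by_cases hyA : y ∈ A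
  · rw [Set.indicator_of_mem hyA, Set.indicator_of_mem (hAB hyA), ← add_mul, mul_comm (p y)]
    exact mul_le_mul' (hA y hyA) le_rfl
  · rw [Set.indicator_of_notMem hyA, mul_zero, zero_add]
    by_cases hyB : y ∈ B
    · rw [Set.indicator_of_mem hyB, mul_comm (p y)]
      exact mul_le_mul' (hB y hyB) le_rfl
    · rw [Set.indicator_of_notMem hyB, mul_zero]
      exact bot_le

/-- **The median of a good majority.** If a list `S` of strings is sorted by value (`bitsToNat`)
and more than half of its entries have a good value, for a predicate on values closed under
betweenness (an interval condition), then the middle entry `S[|S|/2]` has a good value: were it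
bad, all good entries would lie on one side of it, and either side holds at most half of the list.
[cite: JerrumValiantVazirani1986, Lemma 6.1 (proof: the median of a majority inside an interval)] -/
theorem good_getD_of_majority {P : ℕ → Prop} [DecidablePred P]
    (hP : ∀ r₁ r₂ r, P r₁ → P r₂ → r₁ ≤ r → r ≤ r₂ → P r)
    {S : List (List Bool)} (hS : S.Pairwise FPRASAmp.ValLE)
    (hmaj : S.length < 2 * S.countP fun a => decide (P (bitsToNat a))) :
    P (bitsToNat (S.getD (S.length / 2) [])) := by
  set m := S.length with hm
  set Q : List Bool → Bool := fun a => decide (P (bitsToNat a)) with hQ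
  have hne : S ≠ [] := by rintro rfl; simp [hm] at hmaj
  have hlt : m / 2 < m := Nat.div_lt_self (by rw [hm]; exact List.length_pos_iff.2 hne) one_lt_two
  set mid := S[m / 2]'hlt with hmid
  have hgetD : S.getD (m / 2) [] = mid := by
    rw [List.getD_eq_getElem?_getD, List.getElem?_eq_getElem hlt, Option.getD_some]
  rw [hgetD]
  have hsplit : S = S.take (m / 2) ++ mid :: S.drop (m / 2 + 1) := by
    rw [hmid, ← List.drop_eq_getElem_cons hlt, List.take_append_drop]
  have hlenT : (S.take (m / 2)).length = m / 2 := by rw [List.length_take]; omega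
  have hlenD : (S.drop (m / 2 + 1)).length = m - (m / 2 + 1) := by rw [List.length_drop]
  have hsorted := hS
  rw [hsplit, List.pairwise_append, List.pairwise_cons] at hsorted
  obtain ⟨-, ⟨hmidD, -⟩, hTmid⟩ := hsorted
  have hcount : S.countP Q = (S.take (m / 2)).countP Q +
      ((S.drop (m / 2 + 1)).countP Q + if Q mid = true then 1 else 0) := by
    conv_lhs => rw [hsplit]
    rw [List.countP_append, List.countP_cons]
  have hcT : (S.take (m / 2)).countP Q ≤ (S.take (m / 2)).length := List.countP_le_length
  have hcD : (S.drop (m / 2 + 1)).countP Q ≤ (S.drop (m / 2 + 1)).length := List.countP_le_length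
  by_contra hnot
  have hQmid : Q mid = false := by simpa [hQ] using hnot
  rw [hQmid] at hcount
  simp only [Bool.false_eq_true, if_false, add_zero] at hcount
  by_cases hT : ∃ a ∈ S.take (m / 2), Q a = true
  · obtain ⟨a, ha, hQa⟩ := hT
    have hD0 : (S.drop (m / 2 + 1)).countP Q = 0 := by
      rw [List.countP_eq_zero]
      intro b hb hQb
      have h1 : bitsToNat a ≤ bitsToNat mid := hTmid a ha mid List.mem_cons_self
      have h2 : bitsToNat mid ≤ bitsToNat b := hmidD b hb
      exact hnot (hP _ _ _ (by simpa [hQ] using hQa) (by simpa [hQ] using hQb) h1 h2)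
    rw [hD0] at hcount
    omega
  · have hT0 : (S.take (m / 2)).countP Q = 0 := by
      rw [List.countP_eq_zero]
      intro a ha hQa
      exact hT ⟨a, ha, hQa⟩
    rw [hT0] at hcount
    omega

/-- The length of the code `encList l` of a list of strings of length `≤ B`: at most
`|l|·(2B + 2)`. [folklore] -/
theorem length_encList_le {B : ℕ} : ∀ {l : List (List Bool)}, (∀ a ∈ l, a.length ≤ B) →
    (encList l).length ≤ l.length * (2 * B + 2)
  | [], _ => by simp
  | a :: l, h => by
    rw [encList_cons, length_boolPair, List.length_cons]
    have h1 := h a List.mem_cons_self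
    have h2 := length_encList_le fun b hb => h b (List.mem_cons_of_mem a hb)
    have h3 : (l.length + 1) * (2 * B + 2) = l.length * (2 * B + 2) + (2 * B + 2) := by ring
    omega

/-- **Reading item `j` of a coded list**: `fstF (sndF^j (encList l)) = l[j]` (`[]` past the end).
[folklore] -/
theorem fstF_iterate_sndF_encList : ∀ (j : ℕ) (l : List (List Bool)),
    fstF (sndF^[j] (encList l)) = l.getD j []
  | 0, [] => by simp
  | 0, a :: l => by simp [encList_cons]
  | j + 1, [] => by
    rw [encList_nil, Function.iterate_fixed (HashBricks.sndF_nil) (j + 1)]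
    simp
  | j + 1, a :: l => by
    rw [Function.iterate_succ_apply, encList_cons, sndF_boolPair, fstF_iterate_sndF_encList j l]
    simp

/-- A string with the self-delimited prefix `⟨a, t⟩` is a pair `⟨a, s⟩`
(`⟨a, t⟩ ++ r = ⟨a, t ++ r⟩`). [folklore] -/
theorem exists_eq_boolPair_of_prefix {a t y : List Bool} (h : boolPair a t <+: y) :
    ∃ s, y = boolPair a s := by
  obtain ⟨s, rfl⟩ := h
  exact ⟨t ++ s, Cryptography.boolPair_append a t s⟩

/-- The probability of an output event, as a mass of the output law (`kernelProb` is its real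
part, and masses of a `PMF` are finite). [folklore] -/
theorem ofReal_kernelProb (F : QCircuitFamily cliffordT) (A : Language Bool) (x : List Bool)
    (E : Set (List Bool)) :
    ENNReal.ofReal (F.kernelProb A x E) = (F.kernel A x).toOuterMeasure E := by
  unfold QCircuitFamily.kernelProb
  refine ENNReal.ofReal_toReal (ne_top_of_le_ne_top ENNReal.one_ne_top ?_)
  exact ((F.kernel A x).toOuterMeasure.mono (Set.subset_univ E)).trans_eq
    (((F.kernel A x).toOuterMeasure_apply_eq_one_iff _).2 (Set.subset_univ _))

/-- Output events may be intersected with the support of the output law. [folklore] -/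
theorem kernelProb_inter_support (F : QCircuitFamily cliffordT) (A : Language Bool) (x : List Bool)
    (E : Set (List Bool)) : F.kernelProb A x (E ∩ (F.kernel A x).support) = F.kernelProb A x E := by
  unfold QCircuitFamily.kernelProb
  rw [PMF.toOuterMeasure_apply_inter_support]

/-- The support of the output law has probability `1`. [folklore] -/
theorem kernelProb_support (F : QCircuitFamily cliffordT) (A : Language Bool) (x : List Bool) :
    F.kernelProb A x (F.kernel A x).support = 1 := by
  unfold QCircuitFamily.kernelProb
  rw [((F.kernel A x).toOuterMeasure_apply_eq_one_iff _).2 subset_rfl, ENNReal.toReal_one]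

/-- Every possible output register of a family on input `u` has length `|u| + ancillas |u|`.
[folklore] -/
theorem length_of_mem_support_kernel (F : QCircuitFamily cliffordT) (A : Language Bool)
    (u y : List Bool) (hy : y ∈ (F.kernel A u).support) :
    y.length = u.length + F.ancillas u.length := by
  obtain ⟨z, -, rfl⟩ := (PMF.mem_support_map_iff _ _ _).1 hy
  exact List.length_ofFn


/-- The sure event has probability `1` (twin of `kernelProb_univ` of `SimonSamplerLaw.lean`,
outside this file's import cone). [folklore] -/
theorem kernelProb_univ (F : QCircuitFamily cliffordT) (A : Language Bool) (x : List Bool) :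
    F.kernelProb A x Set.univ = 1 := by
  unfold QCircuitFamily.kernelProb
  rw [((F.kernel A x).toOuterMeasure_apply_eq_one_iff _).2 (Set.subset_univ _), ENNReal.toReal_one]

/-- Masses of a `PMF` on strings are finite (twin of `toOuterMeasure_ne_top'` of
`CWrapReadLaw.lean`). [folklore] -/
theorem toOuterMeasure_ne_top (p : PMF (List Bool)) (E : Set (List Bool)) :
    p.toOuterMeasure E ≠ ⊤ :=
  ne_top_of_le_ne_top ENNReal.one_ne_top ((p.toOuterMeasure.mono (Set.subset_univ E)).trans_eq
    ((p.toOuterMeasure_apply_eq_one_iff _).2 (Set.subset_univ _)))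

end AdviceChain

end Literature.Computability.QuantumComplexity

end
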